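import Literature.NumberTheory.Automorphic.NewformAdelisationZFinite
import Literature.NumberTheory.Automorphic.NewformAdelisationKFinite
import Literature.NumberTheory.Automorphic.GLnCuspidalSpectrumSiegel
import Literature.NumberTheory.Automorphic.NewformAdelisationCuspidal
import Literature.NumberTheory.Automorphic.AutomorphicRepsGLCuspBridgeProofs
import HarnessLib

/-!
# The adelic lift of a cusp form is a cusp form on `GL₂(𝔸_ℚ)` (Borel–Jacquet 4.2, 4.4)

Topic `NumberTheory/Automorphic`; theorems only (no definition, no named fact; D-0026). Assembly
brick of the dictionary `f ↦ π_f` (Gelbart 1975, §3, Prop. 3.1; Bump 1997, §3.6, Thm. 3.6.1 sketch;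
Borel–Jacquet 1979, 4.2): for a cusp form `f ∈ S_k(Γ₁(N))`, the adelic lift
`φ_f = adelicLiftFunA N k f : GL₂(𝔸_ℚ) → ℂ` satisfies ALL the conditions (a)–(d) of an automorphic
form for the `GL₂/ℚ` automorphy datum:

* (a) `isLeftInvariant_adelicLiftFunA` (`adelicLiftFun_ofGlobal_mul`) and
  `exists_level_adelicLiftFunA` — right invariance under the admissible level `K(N)`
  (`adelicLiftFun_mul_of_mem_principalCongruenceLevel`, `principalCongruenceLevel_mem_finiteLevelsGL_holds`);
* (b) `isArchSmooth_ofArch_adelicLiftFunA_cuspForm` (`NewformAdelisationArchSmooth`) and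
  `isKFinite_adelicLiftFunA` (`NewformAdelisationKFinite`);
* (c) `isZFinite_adelicLiftFunA` (`NewformAdelisationZFinite`, from the Casimir eigenvalue);
* (d) `hasModerateGrowth_adelicLiftFunA` — **`φ_f` is bounded** (the tree's `exists_bound_adelicLiftFun`:
  `‖φ_f‖ = ‖f(τ)‖ (Im τ)^{k/2}` on slices and Mathlib's `CuspFormClass.exists_bound`);

whence `isAutomorphicForm_adelicLiftFunA : IsAutomorphicForm (AutomorphyDatum.gl 2 ℚ hcpt) φ_f`; and with
the cusp condition (`cuspConditionGL_adelicLiftFunA`, from the tree's `constantTermVanishes_adelicLift`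
through the inversion bridge `AutomorphicRepsGL.cuspConditionGL_invQuot_iff_holds`)
`isCuspFormGL_adelicLiftFunA : IsCuspFormGL 2 ℚ hcpt φ_f`, `adelicLiftFunA_mem_cuspFormsGL`.

## References

* A. Borel, H. Jacquet, *Automorphic forms and automorphic representations*, Corvallis 1979, 4.2.
  [BorelJacquet1979]
* S. Gelbart, *Automorphic forms on adele groups* (1975), §3, Prop. 3.1. [Gelbart1975]
* D. Bump, *Automorphic Forms and Representations* (1997), §3.6. [Bump1997]
-/

noncomputable section

open scoped MatrixGroups Matrix Manifold Classical
open NumberField NumberField.mixedEmbedding UpperHalfPlane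

namespace Literature.NumberTheory.Automorphic


/-! ### (d) Moderate growth -/

section Bounded

variable {N : ℕ} [NeZero N] {k : ℤ} (f : CuspForm (CongruenceSubgroup.Gamma1 N) k)
  (hcpt : isCompact_glFiniteIntegralLevel 2 ℚ)

/-- **(d) `φ_f` has moderate growth** (it is bounded, `exists_bound_adelicLiftFun`; exponent `r = 0`).
Gelbart 1975, Prop. 3.1 (iv). [cite: BorelJacquet1979, 4.2 (d)] [cite: Gelbart1975, Prop. 3.1] -/
theorem hasModerateGrowth_adelicLiftFunA :
    HasModerateGrowth (AutomorphyDatum.gl 2 ℚ hcpt) (adelicLiftFunA N k f) := by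
  obtain ⟨C, hC⟩ := exists_bound_adelicLiftFun (N := N) (k := k) f
  exact ⟨C, 0, fun g => by rw [pow_zero, mul_one]; exact hC g⟩

end Bounded

/-! ### (a) Invariance, and the assembly -/

section Assembly

variable {N : ℕ} [NeZero N] {k : ℤ} (f : CuspForm (CongruenceSubgroup.Gamma1 N) k)
  (hcpt : isCompact_glFiniteIntegralLevel 2 ℚ)

/-- **(a) `φ_f` is left `GL₂(ℚ)`-invariant.** [cite: Gelbart1975, Prop. 3.1] -/
theorem isLeftInvariant_adelicLiftFunA :
    IsLeftInvariant (AdelicGroupData.gl 2 ℚ) (adelicLiftFunA N k f) := by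
  rintro _ ⟨γ, rfl⟩ g
  exact adelicLiftFun_ofGlobal_mul f γ g

/-- **(a) `φ_f` is right invariant under the admissible level `K(N)`.**
[cite: Gelbart1975, Prop. 3.1] [cite: BorelJacquet1979, 4.2 (a)] -/
theorem exists_level_adelicLiftFunA :
    ∃ U ∈ (AutomorphyDatum.gl 2 ℚ hcpt).finiteLevels, IsRightInvariantUnder U (adelicLiftFunA N k f) := by
  refine ⟨principalCongruenceLevel 2 ℚ (Ideal.span {(N : 𝓞 ℚ)}),
    principalCongruenceLevel_mem_finiteLevelsGL_holds 2 ℚ ?_, fun u hu g => ?_⟩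
  · intro h
    rw [Ideal.zero_eq_bot, Ideal.span_singleton_eq_bot] at h
    exact NeZero.ne N (by exact_mod_cast h)
  · exact adelicLiftFun_mul_of_mem_principalCongruenceLevel f hu g

/-- **The adelic lift of a cusp form `f ∈ S_k(Γ₁(N))` is an automorphic form on `GL₂(𝔸_ℚ)`** in the
sense of Borel–Jacquet 1979, 4.2, for the `GL₂/ℚ` automorphy datum: (a) left `GL₂(ℚ)`-invariant and
right `K(N)`-invariant, (b) smooth and `K_∞`-finite, (c) `Z(𝔤)`-finite, (d) of moderate growth.
Gelbart 1975, Prop. 3.1; Bump 1997, §3.6. [cite: BorelJacquet1979, 4.2] [cite: Gelbart1975, Prop. 3.1] -/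
theorem isAutomorphicForm_adelicLiftFunA :
    IsAutomorphicForm (AutomorphyDatum.gl 2 ℚ hcpt) (adelicLiftFunA N k f) where
  leftInvariant := isLeftInvariant_adelicLiftFunA f
  exists_level := exists_level_adelicLiftFunA f hcpt
  archSmooth := isArchSmooth_ofArch_adelicLiftFunA_cuspForm f
  kFinite := isKFinite_adelicLiftFunA f
  zFinite := isZFinite_adelicLiftFunA f
  moderateGrowth := hasModerateGrowth_adelicLiftFunA f hcpt

/-- `φ_f ∈ 𝒜(GL₂(ℚ)\GL₂(𝔸_ℚ))`. [cite: BorelJacquet1979, 4.2] -/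
theorem adelicLiftFunA_mem_automorphicForms :
    adelicLiftFunA N k f ∈ automorphicForms (AutomorphyDatum.gl 2 ℚ hcpt) :=
  (isAutomorphicForm_adelicLiftFunA f hcpt).mem_automorphicForms

end Assembly


/-! ### Cuspidality: `φ_f ∈ 𝒜₀(GL₂(ℚ)\GL₂(𝔸_ℚ))` -/

section Cuspidal

variable {N : ℕ} [NeZero N] {k : ℤ} (f : CuspForm (CongruenceSubgroup.Gamma1 N) k)
  (hcpt : isCompact_glFiniteIntegralLevel 2 ℚ)

/-- `invQuot (adelicLift N k f) = φ_f`: the trunk's dictionary `F(g) = ψ([g⁻¹])` between functions on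
the left quotient `GL₂(𝔸) ⧸ A_G GL₂(ℚ)` and left-invariant functions returns `adelicLiftFun`
(`adelicLift [x] = φ_f(x⁻¹)`). [folklore] -/
theorem invQuot_adelicLift :
    invQuot (AdelicGroupData.gl 2 ℚ) (adelicLift N k f) = adelicLiftFunA N k f := by
  funext g
  rw [invQuot_apply, adelicLift_toAutomorphicQuotient, adelicLiftFunA_apply]
  exact congrArg (adelicLiftFun N k f) (inv_inv (g : GL (Fin 2) (AdeleRing (𝓞 ℚ) ℚ)))

/-- **The cusp condition for `φ_f`** along the Borel of `GL₂` (Borel–Jacquet 1979, 4.4):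
`∫_{N(ℚ)\N(𝔸)} φ_f(u g) du = 0` for every `g`, every Haar measure and every fundamental domain —
the tree's `constantTermVanishes_adelicLift` (Gelbart 1975, Prop. 3.1 (vii): "`φ_f` is cuspidal
because `f` vanishes at the cusps") transported through the inversion bridge
`AutomorphicRepsGL.cuspConditionGL_invQuot_iff_holds`. [cite: Gelbart1975, Prop. 3.1] [cite: BorelJacquet1979, 4.4] -/
theorem cuspConditionGL_adelicLiftFunA : CuspConditionGL 2 ℚ (adelicLiftFunA N k f) 1 := by
  rw [← invQuot_adelicLift]
  exact (AutomorphicRepsGL.cuspConditionGL_invQuot_iff_holds 2 ℚ (adelicLift N k f) 1).2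
    (constantTermVanishes_adelicLift f)

/-- **The adelic lift of a cusp form `f ∈ S_k(Γ₁(N))` is a cusp form on `GL₂(𝔸_ℚ)`**
(`IsCuspFormGL`: automorphic form + cusp condition along the unique proper standard parabolic).
Gelbart 1975, Prop. 3.1; Bump 1997, Thm. 3.6.1 (sketch). [cite: Gelbart1975, Prop. 3.1] [cite: BorelJacquet1979, 4.4] -/
theorem isCuspFormGL_adelicLiftFunA : IsCuspFormGL 2 ℚ hcpt (adelicLiftFunA N k f) := by
  refine ⟨isAutomorphicForm_adelicLiftFunA f hcpt, fun j hj hj2 => ?_⟩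
  obtain rfl : j = 1 := by omega
  exact cuspConditionGL_adelicLiftFunA f

/-- `φ_f ∈ 𝒜₀(GL₂(ℚ)\GL₂(𝔸_ℚ))`. [cite: BorelJacquet1979, 4.4] -/
theorem adelicLiftFunA_mem_cuspFormsGL : adelicLiftFunA N k f ∈ cuspFormsGL 2 ℚ hcpt :=
  (isCuspFormGL_adelicLiftFunA f hcpt).mem_cuspFormsGL

end Cuspidal

end Literature.NumberTheory.Automorphic
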